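import Literature.AnabelianGeometry.SemiGraphs.ArithMaximalCompact
import Literature.AnabelianGeometry.SemiGraphs.TemperedReconstructionReductionsProofs
import Mathlib.GroupTheory.Commensurable
import HarnessLib

/-!
# [SemiAnbd] Remark 5.3.1, second sentence: intersections with the geometric tempered group (proof-only)

Mochizuki, *Semi-graphs of Anabelioids*, Publ. RIMS **42** (2006) 221–322, §5, manuscript p. 65
[cite: MochizukiSemiAnbd2006, Rmk 5.3.1, p. 65]: "for every vertex `v` of `𝔾`, we obtain an associated
decomposition group `Π^temp_{𝔊,v} ⊆ Π^temp_𝔊` [well-defined up to conjugation in `Π^temp_𝔊`], which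
[…] may be thought of as the commensurator in `Π^temp_𝔊` of `Π^temp_{𝔾,v} := Π^temp_{𝔊,v} ∩ Π^temp_𝔾`.
Similarly, if `b` is a branch of an edge `e` of `𝔾` that abuts to `v`, then we obtain a decomposition
group `Π^temp_{𝔊,b} ⊆ Π^temp_{𝔊,v} ⊆ Π^temp_𝔊` […] the commensurator in `Π^temp_{𝔊,v}` of
`Π^temp_{𝔾,b} := Π^temp_{𝔊,b} ∩ Π^temp_𝔾`. […] Remark 5.3.1. […] Also, the intersection with `Π^temp_𝔾`
of a(n) verticial (respectively, edge-like) subgroup of `Π^temp_𝔊` is a(n) verticial (respectively,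
edge-like) subgroup of `Π^temp_𝔾` in the sense of Theorem 3.7."

PROOF-ONLY companion (abc-iut cell, L3 sub-DAG #4 `plan/L3/SUBDAG-SemiAnbd-Thm54.md`, row **T54-2**,
seat abc-iut-w4-d040) of abc-iut-L3-t3's FROZEN-shape statement file `ArithMaximalCompact.lean`
(p403878), which types the second sentence of Rmk 5.3.1 as the predicate
`IntersectionWithGeometricStatement D aug IsGeomVerticial IsGeomEdgeLike` on the DATA of p. 65
(`D : DecompositionData Gtp V B` = chosen representatives `Π^temp_{𝔊,v}`, `Π^temp_{𝔊,b}`;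
`aug : Π^temp_𝔊 ↠ Π_A`, so `Π^temp_𝔾 = Ker aug` by Prop. 5.2 (iv); the verticial / edge-like subgroups
of `Π^temp_𝔾` in the sense of Thm. 3.7 enter as the predicates `IsGeomVerticial`, `IsGeomEdgeLike`).
No statement file is edited; no `def`, no new named fact.

HONEST SCOPE (sub-DAG header: "every statement is a predicate on abstract DATA; discharges are
RELATIVE to that data until the producer T54-0 instantiates it").  Print's justification consists of
exactly two ingredients, which enter here BY NAME as hypotheses on the data:
* (DEF) `Π^temp_{𝔾,v} := Π^temp_{𝔊,v} ∩ Π^temp_𝔾` IS the decomposition group of `v` in `Π^temp_𝔾`, i.e. a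
  §3-verticial subgroup (p. 65 l. 7–8: this is the DEFINITION of the geometric decomposition group
  attached to the chosen `Π^temp_{𝔊,v}`; for the producer it holds by construction) — `hV`; likewise
  `hB` for branches;
* (OUT) conjugation by ANY element of `Π^temp_𝔊` — not only of `Π^temp_𝔾` — carries §3-verticial
  (resp. edge-like) subgroups of the normal subgroup `Π^temp_𝔾` to §3-verticial (resp. edge-like)
  subgroups: the outer action of `Π_A` on `Π^temp_𝔾` comes from the action of `Π_A` on the semi-graph of
  anabelioids (Def. 5.1 (i)(c)) and so permutes decomposition groups of vertices / branches —
  `hVconj`, `hBconj`.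
Given these, the sentence is the elementary identity `g·(H ∩ N)·g⁻¹ = (g·H·g⁻¹) ∩ N` for the normal
subgroup `N = Π^temp_𝔾` (`conjSubgroup_inf_of_normal`): `intersectionWithGeometricStatement_of`.

The file also records the §3 CURRENCY of (OUT) when `IsGeomVerticial` / `IsGeomEdgeLike` are
instantiated, through an embedding `ι : π₁^temp(𝒢) →* Π^temp_𝔊` of a tempered chart
`c : TemperedPiChart 𝒢` of the geometric component (Prop. 5.2 (iv), `FundamentalExactSequences.exact_tp`:
`ι` injective with range `Ker aug`), by `K ↦ ∃ v, ∃ H ∈ verticialSubgroups c v, K = H.map ι`: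
* the INNER part of (OUT) — conjugation by elements of `Π^temp_𝔾 = ι(c.G)` — is PROVED from §3
  (`conj_mem_verticialSubgroups`, `conj_mem_edgeLikeSubgroups'`: Prop. 3.2 / `BTemp.resIsoOfConj`):
  `isGeomVerticial_conj_of_mem_range`, `isGeomEdgeLike_conj_of_mem_range`;
* hence (OUT) for all of `Π^temp_𝔊` REDUCES to (OUT) on any set `S` of representatives with
  `Π^temp_𝔊 = S · ι(c.G)` (e.g. a set-theoretic section of `aug`, which is what the producer's Def. 5.1
  (i)(c) action supplies): `isGeomVerticial_conj_of_representatives`, `…EdgeLike…`;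
* `intersectionWithGeometricStatement_of_chart` — the assembled T54-2 statement in §3 currency.

Nothing here takes a side on [IUTchIII] Cor. 3.12; typed ≠ proved elsewhere.
-/

namespace Literature.AnabelianGeometry.SemiGraphs

open CategoryTheory Topology

universe u u' w w₁ w₂

/-! ### Group theory: conjugation commutes with intersecting a normal subgroup -/

section GroupTheory

variable {Gtp : Type w} [Group Gtp]

/-- `g · (H ∩ K) · g⁻¹ = (g H g⁻¹) ∩ (g K g⁻¹)` (conjugation is injective).
[cite: MochizukiSemiAnbd2006, Rmk 5.3.1, p. 65] -/
theorem conjSubgroup_inf (g : Gtp) (H K : Subgroup Gtp) :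
    conjSubgroup g (H ⊓ K) = conjSubgroup g H ⊓ conjSubgroup g K :=
  Subgroup.map_inf H K _ (MulAut.conj g).injective

/-- A normal subgroup is its own conjugate. [cite: MochizukiSemiAnbd2006, Rmk 5.3.1, p. 65] -/
theorem conjSubgroup_eq_self_of_normal (g : Gtp) (N : Subgroup Gtp) [N.Normal] :
    conjSubgroup g N = N :=
  Subgroup.Normal.conj_smul_eq_self g N

/-- `g · (H ∩ N) · g⁻¹ = (g H g⁻¹) ∩ N` for `N` normal — the group-theoretic content of Rmk 5.3.1,
second sentence, with `N = Π^temp_𝔾 ⊲ Π^temp_𝔊`. [cite: MochizukiSemiAnbd2006, Rmk 5.3.1, p. 65] -/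
theorem conjSubgroup_inf_of_normal (g : Gtp) (H N : Subgroup Gtp) [N.Normal] :
    conjSubgroup g (H ⊓ N) = conjSubgroup g H ⊓ N := by
  rw [conjSubgroup_inf, conjSubgroup_eq_self_of_normal g N]

/-- `conjSubgroup` is an action: `(g₁ g₂) · K · (g₁ g₂)⁻¹ = g₁ · (g₂ K g₂⁻¹) · g₁⁻¹`.
[cite: MochizukiSemiAnbd2006, §0, p. 5] -/
theorem conjSubgroup_mul (g₁ g₂ : Gtp) (K : Subgroup Gtp) :
    conjSubgroup (g₁ * g₂) K = conjSubgroup g₁ (conjSubgroup g₂ K) := by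
  simp only [conjSubgroup, map_mul, Subgroup.map_map]
  rfl

/-- Conjugating inside a subgroup and then embedding = embedding and then conjugating by the image:
`ι(h · H · h⁻¹) = ι(h) · ι(H) · ι(h)⁻¹`. [cite: MochizukiSemiAnbd2006, §0, p. 5] -/
theorem map_conjSubgroup_eq {Γ : Type u'} [Group Γ] (ι : Γ →* Gtp) (h : Γ) (H : Subgroup Γ) :
    (H.map (MulAut.conj h).toMonoidHom).map ι = conjSubgroup (ι h) (H.map ι) := by
  simp only [conjSubgroup, Subgroup.map_map]
  congr 1
  ext x
  simp [MulAut.conj_apply]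

end GroupTheory

/-! ### Remark 5.3.1, second sentence, relative to the data of p. 65 -/

section Relative

variable {Gtp : Type w} [Group Gtp]
variable {PA : Type u'} [Group PA]
variable {Vx : Type w₁} {Br : Type w₂}

/-- **Rmk 5.3.1, second sentence, DISCHARGED RELATIVE TO THE DATA** (p. 65): for decomposition data
`D` (representatives `Π^temp_{𝔊,v}`, `Π^temp_{𝔊,b}`), the augmentation `aug : Π^temp_𝔊 → Π_A` (so
`Π^temp_𝔾 = Ker aug`, Prop. 5.2 (iv)) and predicates `IsGeomVerticial` / `IsGeomEdgeLike` ("verticial /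
edge-like subgroup of `Π^temp_𝔾` in the sense of Theorem 3.7"), IF (DEF) each
`Π^temp_{𝔊,v} ∩ Π^temp_𝔾` is verticial and each `Π^temp_{𝔊,b} ∩ Π^temp_𝔾` is edge-like (p. 65: these ARE
the geometric decomposition groups `Π^temp_{𝔾,v}`, `Π^temp_{𝔾,b}` by definition) and (OUT) conjugation
by every element of `Π^temp_𝔊` preserves both classes, THEN "the intersection with `Π^temp_𝔾` of a(n)
verticial (respectively, edge-like) subgroup of `Π^temp_𝔊` is a(n) verticial (respectively, edge-like)
subgroup of `Π^temp_𝔾`" — `IntersectionWithGeometricStatement D aug IsGeomVerticial IsGeomEdgeLike`.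
[cite: MochizukiSemiAnbd2006, Rmk 5.3.1, p. 65] -/
theorem intersectionWithGeometricStatement_of (D : DecompositionData Gtp Vx Br) (aug : Gtp →* PA)
    (IsGeomVerticial IsGeomEdgeLike : Subgroup Gtp → Prop)
    (hV : ∀ v : Vx, IsGeomVerticial (D.vertGp v ⊓ aug.ker))
    (hVconj : ∀ (g : Gtp) (K : Subgroup Gtp), IsGeomVerticial K → IsGeomVerticial (conjSubgroup g K))
    (hB : ∀ b : Br, IsGeomEdgeLike (D.brGp b ⊓ aug.ker))
    (hBconj : ∀ (g : Gtp) (K : Subgroup Gtp), IsGeomEdgeLike K → IsGeomEdgeLike (conjSubgroup g K)) :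
    IntersectionWithGeometricStatement D aug IsGeomVerticial IsGeomEdgeLike := by
  refine ⟨fun K hK => ?_, fun K hK => ?_⟩
  · obtain ⟨v, g, rfl⟩ := hK
    rw [← conjSubgroup_inf_of_normal]
    exact hVconj g _ (hV v)
  · obtain ⟨b, g, rfl⟩ := hK
    rw [← conjSubgroup_inf_of_normal]
    exact hBconj g _ (hB b)

/-- (OUT) for all of `Π^temp_𝔊` from (OUT) on a set `S` of representatives of `Π^temp_𝔊 / N` together with
stability under conjugation by the subgroup `N` itself (bookkeeping used for both classes).
[cite: MochizukiSemiAnbd2006, Rmk 5.3.1, p. 65] -/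
theorem conj_stable_of_representatives (P : Subgroup Gtp → Prop) (N : Subgroup Gtp) (S : Set Gtp)
    (hS : ∀ g : Gtp, ∃ s ∈ S, ∃ n ∈ N, g = s * n)
    (hinner : ∀ n ∈ N, ∀ K, P K → P (conjSubgroup n K))
    (houter : ∀ s ∈ S, ∀ K, P K → P (conjSubgroup s K)) :
    ∀ (g : Gtp) (K : Subgroup Gtp), P K → P (conjSubgroup g K) := by
  intro g K hK
  obtain ⟨s, hs, n, hn, rfl⟩ := hS g
  rw [conjSubgroup_mul]
  exact houter s hs _ (hinner n hn K hK)

end Relative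

/-! ### Consequence: nested verticial subgroups are equal (from the commensurator description, p. 65) -/

section Commensurator

open scoped Pointwise

variable {Gtp : Type w} [Group Gtp]
variable {PA : Type u'} [Group PA]
variable {Vx : Type w₁} {Br : Type w₂}

/-- The `ConjAct`-translate of a subgroup is its conjugate `g · K · g⁻¹`. [folklore] -/
private theorem conjAct_smul_eq_conjSubgroup (g : Gtp) (K : Subgroup Gtp) :
    ConjAct.toConjAct g • K = conjSubgroup g K := by
  ext x
  rw [Subgroup.mem_pointwise_smul_iff_inv_smul_mem]
  constructor
  · intro hx
    refine ⟨(ConjAct.toConjAct g)⁻¹ • x, hx, ?_⟩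
    rw [← map_inv, ConjAct.smul_def, ConjAct.ofConjAct_toConjAct]
    simp [MulAut.conj_apply, mul_assoc]
  · rintro ⟨y, hy, rfl⟩
    rw [← map_inv, ConjAct.smul_def, ConjAct.ofConjAct_toConjAct]
    simpa [MulAut.conj_apply, mul_assoc] using hy

/-- Conjugating by `1` does nothing. [folklore] -/
private theorem conjSubgroup_one (K : Subgroup Gtp) : conjSubgroup 1 K = K := by
  ext y
  simp [conjSubgroup]

/-- `conjSubgroup` is monotone. [folklore] -/
private theorem conjSubgroup_mono (x : Gtp) {S T : Subgroup Gtp} (h : S ≤ T) :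
    conjSubgroup x S ≤ conjSubgroup x T :=
  Subgroup.map_mono h

/-- `x · C(K) · x⁻¹ ⊆ C(x K x⁻¹)` for the commensurator `C`. [folklore] -/
private theorem conjSubgroup_commensurator_le (x : Gtp) (K : Subgroup Gtp) :
    conjSubgroup x (Subgroup.Commensurable.commensurator K) ≤
      Subgroup.Commensurable.commensurator (conjSubgroup x K) := by
  rintro _ ⟨h, hh, rfl⟩
  have hh' : Subgroup.Commensurable (ConjAct.toConjAct h • K) K :=
    (Subgroup.Commensurable.commensurator_mem_iff K h).mp hh
  rw [Subgroup.Commensurable.commensurator_mem_iff, ← conjAct_smul_eq_conjSubgroup, smul_smul,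
    MulEquiv.coe_toMonoidHom, MulAut.conj_apply, ← map_mul, inv_mul_cancel_right, map_mul, ← smul_smul]
  exact hh'.conj (ConjAct.toConjAct x)

/-- The commensurator is conjugation-equivariant: `C(x K x⁻¹) = x · C(K) · x⁻¹` (the bookkeeping
behind "well-defined up to conjugation … may be thought of as the commensurator", p. 65).
[cite: MochizukiSemiAnbd2006, §5, p. 65] -/
theorem commensurator_conjSubgroup (x : Gtp) (K : Subgroup Gtp) :
    Subgroup.Commensurable.commensurator (conjSubgroup x K) =
      conjSubgroup x (Subgroup.Commensurable.commensurator K) := by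
  refine le_antisymm ?_ (conjSubgroup_commensurator_le x K)
  have h := conjSubgroup_commensurator_le x⁻¹ (conjSubgroup x K)
  rw [← conjSubgroup_mul, inv_mul_cancel, conjSubgroup_one] at h
  have h2 := conjSubgroup_mono x h
  rwa [← conjSubgroup_mul, mul_inv_cancel, conjSubgroup_one] at h2

/-- "`Π^temp_{𝔊,v}` … may be thought of as the commensurator in `Π^temp_𝔊` of
`Π^temp_{𝔾,v} := Π^temp_{𝔊,v} ∩ Π^temp_𝔾`" (p. 65), stated for the chosen representatives, TRANSPORTS to every
verticial subgroup (conjugation-equivariance of commensurators and of `(-) ∩ Π^temp_𝔾`).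
[cite: MochizukiSemiAnbd2006, §5, p. 65] -/
theorem commensurator_inf_ker_eq_of_isVerticial (D : DecompositionData Gtp Vx Br) (aug : Gtp →* PA)
    (hcomm : ∀ v : Vx, Subgroup.Commensurable.commensurator (D.vertGp v ⊓ aug.ker) = D.vertGp v)
    {W : Subgroup Gtp} (hW : IsVerticial D W) :
    Subgroup.Commensurable.commensurator (W ⊓ aug.ker) = W := by
  obtain ⟨v, g, rfl⟩ := hW
  rw [← conjSubgroup_inf_of_normal, commensurator_conjSubgroup, hcomm v]

/-- The same for edge-like subgroups: "`Π^temp_{𝔊,b}` … the commensurator in `Π^temp_{𝔊,v}` of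
`Π^temp_{𝔾,b}`" implies, a fortiori for the ambient commensurator whenever it is recorded for the
representatives, the transport to all edge-like subgroups. [cite: MochizukiSemiAnbd2006, §5, p. 65] -/
theorem commensurator_inf_ker_eq_of_isEdgeLike (D : DecompositionData Gtp Vx Br) (aug : Gtp →* PA)
    (hcomm : ∀ b : Br, Subgroup.Commensurable.commensurator (D.brGp b ⊓ aug.ker) = D.brGp b)
    {E : Subgroup Gtp} (hE : IsEdgeLike D E) :
    Subgroup.Commensurable.commensurator (E ⊓ aug.ker) = E := by
  obtain ⟨b, g, rfl⟩ := hE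
  rw [← conjSubgroup_inf_of_normal, commensurator_conjSubgroup, hcomm b]

/-- **Nested verticial subgroups of `Π^temp_𝔊` are equal** — the input (H-inc) of the Thm 5.4 (ii)
reduction (abc-iut-w4-d085, `ArithMaximalCompactReductions`) — FROM Rmk 5.3.1 and the geometric
Thm 3.7 (ii)/(iv): if `W ⊆ W'` are verticial, their geometric parts `W ∩ Π^temp_𝔾 ⊆ W' ∩ Π^temp_𝔾` are
verticial subgroups of `Π^temp_𝔾` (`IntersectionWithGeometricStatement`), hence EQUAL ("nested verticial
subgroups of `π₁^temp(𝒢)` are equal", Thm 3.7 (ii): `hgeom`), and `W`, `W'` are recovered as the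
commensurators of these geometric parts (p. 65: `hcomm`), hence equal.
[cite: MochizukiSemiAnbd2006, Rmk 5.3.1 / Thm 5.4, pp. 65–66] -/
theorem isVerticial_eq_of_le (D : DecompositionData Gtp Vx Br) (aug : Gtp →* PA)
    (IsGeomVerticial IsGeomEdgeLike : Subgroup Gtp → Prop)
    (hint : IntersectionWithGeometricStatement D aug IsGeomVerticial IsGeomEdgeLike)
    (hcomm : ∀ v : Vx, Subgroup.Commensurable.commensurator (D.vertGp v ⊓ aug.ker) = D.vertGp v)
    (hgeom : ∀ H H' : Subgroup Gtp, IsGeomVerticial H → IsGeomVerticial H' → H ≤ H' → H = H')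
    {W W' : Subgroup Gtp} (hW : IsVerticial D W) (hW' : IsVerticial D W') (hle : W ≤ W') : W = W' := by
  have h1 : W ⊓ aug.ker = W' ⊓ aug.ker :=
    hgeom _ _ (hint.1 W hW) (hint.1 W' hW') (inf_le_inf_right _ hle)
  rw [← commensurator_inf_ker_eq_of_isVerticial D aug hcomm hW,
    ← commensurator_inf_ker_eq_of_isVerticial D aug hcomm hW', h1]

/-- **Nested edge-like subgroups of `Π^temp_𝔊` are equal** (input (H-β₂) of the Thm 5.4 (ii) reduction)
from the same two ingredients for branches: the geometric parts are nested edge-like subgroups of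
`Π^temp_𝔾`, equal by the geometric input `hgeom` (edge-like subgroups of `π₁^temp(𝒢)` are incomparable:
Thm 3.7 (iv) / commensurable terminality), and the commensurator description recovers `E`, `E'`.
[cite: MochizukiSemiAnbd2006, Rmk 5.3.1 / Thm 5.4, pp. 65–66] -/
theorem isEdgeLike_eq_of_le (D : DecompositionData Gtp Vx Br) (aug : Gtp →* PA)
    (IsGeomVerticial IsGeomEdgeLike : Subgroup Gtp → Prop)
    (hint : IntersectionWithGeometricStatement D aug IsGeomVerticial IsGeomEdgeLike)
    (hcomm : ∀ b : Br, Subgroup.Commensurable.commensurator (D.brGp b ⊓ aug.ker) = D.brGp b)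
    (hgeom : ∀ L L' : Subgroup Gtp, IsGeomEdgeLike L → IsGeomEdgeLike L' → L ≤ L' → L = L')
    {E E' : Subgroup Gtp} (hE : IsEdgeLike D E) (hE' : IsEdgeLike D E') (hle : E ≤ E') : E = E' := by
  have h1 : E ⊓ aug.ker = E' ⊓ aug.ker :=
    hgeom _ _ (hint.2 E hE) (hint.2 E' hE') (inf_le_inf_right _ hle)
  rw [← commensurator_inf_ker_eq_of_isEdgeLike D aug hcomm hE,
    ← commensurator_inf_ker_eq_of_isEdgeLike D aug hcomm hE', h1]

/-- **A verticial subgroup is determined by its geometric part**: two verticial subgroups of `Π^temp_𝔊`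
with the same intersection with `Π^temp_𝔾` coincide (commensurator description, p. 65).
[cite: MochizukiSemiAnbd2006, §5, p. 65] -/
theorem isVerticial_eq_of_inf_ker_eq (D : DecompositionData Gtp Vx Br) (aug : Gtp →* PA)
    (hcomm : ∀ v : Vx, Subgroup.Commensurable.commensurator (D.vertGp v ⊓ aug.ker) = D.vertGp v)
    {W W' : Subgroup Gtp} (hW : IsVerticial D W) (hW' : IsVerticial D W')
    (h : W ⊓ aug.ker = W' ⊓ aug.ker) : W = W' := by
  rw [← commensurator_inf_ker_eq_of_isVerticial D aug hcomm hW,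
    ← commensurator_inf_ker_eq_of_isVerticial D aug hcomm hW', h]

end Commensurator

/-! ### The §3 currency: verticial / edge-like subgroups of a tempered chart of the geometric component -/

namespace ProfiniteSemiGraph

variable {𝒢 : ProfiniteSemiGraph.{u}} (c : TemperedPiChart 𝒢)
variable {Gtp : Type w} [Group Gtp]
variable {PA : Type u'} [Group PA]
variable {Vx : Type w₁} {Br : Type w₂}

/-- INNER part of (OUT), vertices — PROVED from §3: if `ι : π₁^temp(𝒢) → Π^temp_𝔊` embeds a tempered
chart of the geometric component, then conjugation by an element `ι h` of its image carries the image
`ι(H)` of a verticial subgroup `H` at `v` to the image of a verticial subgroup at the SAME `v` (the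
verticial subgroups at `v` form one conjugacy class: Prop. 3.2, `conj_mem_verticialSubgroups`).
[cite: MochizukiSemiAnbd2006, Thm 3.7(i) p.40] -/
theorem isGeomVerticial_conj_of_mem_range (ι : c.G →* Gtp) {g : Gtp} (hg : g ∈ ι.range)
    {K : Subgroup Gtp} (hK : ∃ v : 𝒢.graph.Vertex, ∃ H ∈ verticialSubgroups c v, K = H.map ι) :
    ∃ v : 𝒢.graph.Vertex, ∃ H ∈ verticialSubgroups c v, conjSubgroup g K = H.map ι := by
  obtain ⟨h, rfl⟩ := hg
  obtain ⟨v, H, hH, rfl⟩ := hK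
  exact ⟨v, _, conj_mem_verticialSubgroups c hH h, (map_conjSubgroup_eq ι h H).symm⟩

/-- INNER part of (OUT), edges — PROVED from §3 (`conj_mem_edgeLikeSubgroups'`).
[cite: MochizukiSemiAnbd2006, Thm 3.7(iii) p.41] -/
theorem isGeomEdgeLike_conj_of_mem_range (ι : c.G →* Gtp) {g : Gtp} (hg : g ∈ ι.range)
    {K : Subgroup Gtp} (hK : ∃ e : 𝒢.graph.Edge, ∃ L ∈ edgeLikeSubgroups c e, K = L.map ι) :
    ∃ e : 𝒢.graph.Edge, ∃ L ∈ edgeLikeSubgroups c e, conjSubgroup g K = L.map ι := by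
  obtain ⟨h, rfl⟩ := hg
  obtain ⟨e, L, hL, rfl⟩ := hK
  exact ⟨e, _, conj_mem_edgeLikeSubgroups' c hL h, (map_conjSubgroup_eq ι h L).symm⟩

/-- (OUT) for ALL of `Π^temp_𝔊`, vertices, REDUCED to a set `S` of coset representatives of
`Π^temp_𝔊 / ι(π₁^temp(𝒢))` ("the outer action of `Π_A`", Def. 5.1 (i)(c)): if conjugation by each
`s ∈ S` permutes the images of verticial subgroups, so does conjugation by every `g ∈ Π^temp_𝔊` (the
inner part being `isGeomVerticial_conj_of_mem_range`). [cite: MochizukiSemiAnbd2006, Rmk 5.3.1, p. 65] -/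
theorem isGeomVerticial_conj_of_representatives (ι : c.G →* Gtp) (S : Set Gtp)
    (hS : ∀ g : Gtp, ∃ s ∈ S, ∃ n ∈ ι.range, g = s * n)
    (houter : ∀ s ∈ S, ∀ K : Subgroup Gtp,
      (∃ v : 𝒢.graph.Vertex, ∃ H ∈ verticialSubgroups c v, K = H.map ι) →
        ∃ v : 𝒢.graph.Vertex, ∃ H ∈ verticialSubgroups c v, conjSubgroup s K = H.map ι)
    (g : Gtp) (K : Subgroup Gtp)
    (hK : ∃ v : 𝒢.graph.Vertex, ∃ H ∈ verticialSubgroups c v, K = H.map ι) :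
    ∃ v : 𝒢.graph.Vertex, ∃ H ∈ verticialSubgroups c v, conjSubgroup g K = H.map ι :=
  conj_stable_of_representatives
    (fun K => ∃ v : 𝒢.graph.Vertex, ∃ H ∈ verticialSubgroups c v, K = H.map ι) ι.range S hS
    (fun _ hn _ hK => isGeomVerticial_conj_of_mem_range c ι hn hK) houter g K hK

/-- (OUT) for ALL of `Π^temp_𝔊`, edges, reduced to coset representatives likewise.
[cite: MochizukiSemiAnbd2006, Rmk 5.3.1, p. 65] -/
theorem isGeomEdgeLike_conj_of_representatives (ι : c.G →* Gtp) (S : Set Gtp)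
    (hS : ∀ g : Gtp, ∃ s ∈ S, ∃ n ∈ ι.range, g = s * n)
    (houter : ∀ s ∈ S, ∀ K : Subgroup Gtp,
      (∃ e : 𝒢.graph.Edge, ∃ L ∈ edgeLikeSubgroups c e, K = L.map ι) →
        ∃ e : 𝒢.graph.Edge, ∃ L ∈ edgeLikeSubgroups c e, conjSubgroup s K = L.map ι)
    (g : Gtp) (K : Subgroup Gtp)
    (hK : ∃ e : 𝒢.graph.Edge, ∃ L ∈ edgeLikeSubgroups c e, K = L.map ι) :
    ∃ e : 𝒢.graph.Edge, ∃ L ∈ edgeLikeSubgroups c e, conjSubgroup g K = L.map ι :=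
  conj_stable_of_representatives
    (fun K => ∃ e : 𝒢.graph.Edge, ∃ L ∈ edgeLikeSubgroups c e, K = L.map ι) ι.range S hS
    (fun _ hn _ hK => isGeomEdgeLike_conj_of_mem_range c ι hn hK) houter g K hK

/-- A set-theoretic section of `aug` over the exact sequence `1 → π₁^temp(𝒢) →ι Π^temp_𝔊 →aug Π_A → 1`
(Prop. 5.2 (iv), `FundamentalExactSequences.exact_tp`) supplies coset representatives: every
`g ∈ Π^temp_𝔊` is `σ(aug g) · ι(h)`. [cite: MochizukiSemiAnbd2006, Prop 5.2 (iv), p. 64] -/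
theorem exists_repr_of_section (ι : c.G →* Gtp) (aug : Gtp →* PA) (hexact : ι.range = aug.ker)
    (σ : PA → Gtp) (hσ : ∀ a, aug (σ a) = a) (g : Gtp) :
    ∃ s ∈ Set.range σ, ∃ n ∈ ι.range, g = s * n := by
  refine ⟨σ (aug g), ⟨aug g, rfl⟩, (σ (aug g))⁻¹ * g, ?_, by rw [mul_inv_cancel_left]⟩
  rw [hexact, MonoidHom.mem_ker, map_mul, map_inv, hσ, inv_mul_cancel]

/-- **T54-2 in §3 currency** (Rmk 5.3.1, second sentence, p. 65): let `c` be a tempered chart of the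
geometric component `𝒢`, `ι : π₁^temp(𝒢) → Π^temp_𝔊` and `aug : Π^temp_𝔊 → Π_A` with `ι(π₁^temp(𝒢)) = Ker aug`
(Prop. 5.2 (iv)), `σ` a set-theoretic section of `aug`; let the verticial / edge-like subgroups "of
`Π^temp_𝔾` in the sense of Theorem 3.7" be the images under `ι` of the §3 ones (`verticialSubgroups c v`,
`edgeLikeSubgroups c e`).  IF (DEF) each `Π^temp_{𝔊,v} ∩ Ker aug`, `Π^temp_{𝔊,b} ∩ Ker aug` is such an
image (p. 65: definition of `Π^temp_{𝔾,v}`, `Π^temp_{𝔾,b}`) and (OUT) conjugation by the representatives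
`σ(a)`, `a ∈ Π_A`, permutes these images (the action of `Π_A` on the semi-graph of anabelioids,
Def. 5.1 (i)(c)), THEN `IntersectionWithGeometricStatement` holds — the inner conjugations being
handled by §3 itself (`conj_mem_verticialSubgroups`, Prop. 3.2). [cite: MochizukiSemiAnbd2006, Rmk 5.3.1, p. 65] -/
theorem intersectionWithGeometricStatement_of_chart (D : DecompositionData Gtp Vx Br)
    (ι : c.G →* Gtp) (aug : Gtp →* PA) (hexact : ι.range = aug.ker)
    (σ : PA → Gtp) (hσ : ∀ a, aug (σ a) = a)
    (hV : ∀ v : Vx, ∃ w : 𝒢.graph.Vertex, ∃ H ∈ verticialSubgroups c w, D.vertGp v ⊓ aug.ker = H.map ι)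
    (hVout : ∀ (a : PA) (K : Subgroup Gtp),
      (∃ w : 𝒢.graph.Vertex, ∃ H ∈ verticialSubgroups c w, K = H.map ι) →
        ∃ w : 𝒢.graph.Vertex, ∃ H ∈ verticialSubgroups c w, conjSubgroup (σ a) K = H.map ι)
    (hB : ∀ b : Br, ∃ e : 𝒢.graph.Edge, ∃ L ∈ edgeLikeSubgroups c e, D.brGp b ⊓ aug.ker = L.map ι)
    (hBout : ∀ (a : PA) (K : Subgroup Gtp),
      (∃ e : 𝒢.graph.Edge, ∃ L ∈ edgeLikeSubgroups c e, K = L.map ι) →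
        ∃ e : 𝒢.graph.Edge, ∃ L ∈ edgeLikeSubgroups c e, conjSubgroup (σ a) K = L.map ι) :
    IntersectionWithGeometricStatement D aug
      (fun K => ∃ w : 𝒢.graph.Vertex, ∃ H ∈ verticialSubgroups c w, K = H.map ι)
      (fun K => ∃ e : 𝒢.graph.Edge, ∃ L ∈ edgeLikeSubgroups c e, K = L.map ι) := by
  have hS : ∀ g : Gtp, ∃ s ∈ Set.range σ, ∃ n ∈ ι.range, g = s * n :=
    exists_repr_of_section c ι aug hexact σ hσ
  refine intersectionWithGeometricStatement_of D aug _ _ hV ?_ hB ?_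
  · refine isGeomVerticial_conj_of_representatives c ι (Set.range σ) hS ?_
    rintro _ ⟨a, rfl⟩ K hK
    exact hVout a K hK
  · refine isGeomEdgeLike_conj_of_representatives c ι (Set.range σ) hS ?_
    rintro _ ⟨a, rfl⟩ K hK
    exact hBout a K hK

/-- The same with (OUT) supplied for EVERY `g ∈ Π^temp_𝔊` directly (the form a producer acting on the
whole covering tower delivers; no section of `aug` needed). [cite: MochizukiSemiAnbd2006, Rmk 5.3.1, p. 65] -/
theorem intersectionWithGeometricStatement_of_chart_of_forall (D : DecompositionData Gtp Vx Br)
    (ι : c.G →* Gtp) (aug : Gtp →* PA)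
    (hV : ∀ v : Vx, ∃ w : 𝒢.graph.Vertex, ∃ H ∈ verticialSubgroups c w, D.vertGp v ⊓ aug.ker = H.map ι)
    (hVout : ∀ (g : Gtp) (K : Subgroup Gtp),
      (∃ w : 𝒢.graph.Vertex, ∃ H ∈ verticialSubgroups c w, K = H.map ι) →
        ∃ w : 𝒢.graph.Vertex, ∃ H ∈ verticialSubgroups c w, conjSubgroup g K = H.map ι)
    (hB : ∀ b : Br, ∃ e : 𝒢.graph.Edge, ∃ L ∈ edgeLikeSubgroups c e, D.brGp b ⊓ aug.ker = L.map ι)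
    (hBout : ∀ (g : Gtp) (K : Subgroup Gtp),
      (∃ e : 𝒢.graph.Edge, ∃ L ∈ edgeLikeSubgroups c e, K = L.map ι) →
        ∃ e : 𝒢.graph.Edge, ∃ L ∈ edgeLikeSubgroups c e, conjSubgroup g K = L.map ι) :
    IntersectionWithGeometricStatement D aug
      (fun K => ∃ w : 𝒢.graph.Vertex, ∃ H ∈ verticialSubgroups c w, K = H.map ι)
      (fun K => ∃ e : 𝒢.graph.Edge, ∃ L ∈ edgeLikeSubgroups c e, K = L.map ι) :=
  intersectionWithGeometricStatement_of D aug _ _ hV hVout hB hBout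

end ProfiniteSemiGraph

end Literature.AnabelianGeometry.SemiGraphs
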